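import Summits.QuantumFields.YangMills.Theorems.UnitScaleTiltHalvingHSiteRawP5BaseOfLeaf
import Literature.MathematicalPhysics.QuantumFieldTheory.Balaban1983to89.B8SockHFP59GammaTraceFree
import Literature.MathematicalPhysics.QuantumFieldTheory.Balaban1983to89.B8Prop5KLevelLettersG
import Literature.MathematicalPhysics.QuantumFieldTheory.Balaban1983to89.B8CubeMemberLamBPrimeLaws
import Literature.MathematicalPhysics.QuantumFieldTheory.Balaban1983to89.B8LeafKnitZd3CubBdryBeta
import Literature.MathematicalPhysics.QuantumFieldTheory.Balaban1983to89.B8Ineq133CubeMemberGamma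
import HarnessLib

/-!
# `hP1room` PROGRAMME — EDITION γ, v9 «hT4TLγ-REDUCE-γ + SLetτ-DISCHARGE» (LEAD-H ★w5-19200 g7 WORDS 12∕14∕15; px10 g3 LOCATE (L-B) 125947dd), FILE (3a):
# ★★ THEOREM 4's RAW PROPOSITION-5 SOCKETS `hP5baseγ` ∕ `hP5γ` IN `G`-FORM WITH SUPPORT AT N05's CUBE MEMBER OF RECORD, FLAT BACKGROUND, FROM THE [4] LETTERS
# (+ their `τ`-laws) AT EVERY TRUNCATION AND THEOREM 4's OWN (1.59) CLAUSE PER DATUM — the γ twins of ✓`HalvingHSiteRawP5BaseOfLeaf.rawP5base_of_lettersτ_cubeMember`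
# (FILE A′) and ✓`HalvingHSiteRawP5OfLeaf.rawP5_of_lettersτ_cubeMember` (FILE A)

Route `UnitScaleTilt`, crux K1 child «MinimiserStabilityRegPr» (stmt-QuantumFields-19200), registered stub `stub_halvingStep` (`BirthV10`).  Cell `ym3-torus` (HUMAN RULING
D-0037: YM₃ on T³ is ladder rung R3 — NOT d = 4, NOT a mass gap, NOT the Clay problem), width seat `ym3-torus-px9` gen 5 (LEAD-H WORD 15 «v9 (3) LEAF FILES → px9 g5»).
`--supports stmt-QuantumFields-19200 --as helper`; THEOREMS ONLY (0 `def`, 0 `sorry`); count-neutral; nothing here claims `hT4Tγ`, `hT4TLγ`, `hSupUρ5`, the stub, the crux or the gap.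

WHY (LEAD-H WORDS 12∕14: v9).  px3 g4's FILE (2) `hT4Tγ_of_rawSocketsγ` reduces the guarded Theorem-4 socket with support clause `hT4Tγ` to THREE raw γ-sockets `hP5baseγ hP5γ H59γ`
(∀ `gJ`-closed under J3's guards).  THIS FILE serves the two Proposition-5 sockets at N05's cube member of record `(Ω, Λs, Λb) := (cubeFam false L a M ρ k, cubeLamS …, cubeLamBP′ …)`,
flat background `U₀ := 1 ∈ G`, for a `G`-valued pre-gauged field `U′` carrying J3's three rows ((1.34)-𝔄 on `ℤᵈ`, axial at `1` for every family, tower row (d) `< α₁`), generic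
C⋆-algebra `𝔸` and groups `G ≤ H` (at `M₂(ℂ)`: `SU(2) ≤ SL(2, ℂ)`):
* (FILE (3a′) ✓`HalvingHSiteRawP5BaseGammaOfLeaf.rawP5baseγ_of_lettersτ_cubeMember` — the BASE socket with support, v6 FILE A′'s γ twin.)
* ★★ `rawP5γ_of_lettersτ_cubeMember` — the STEP socket (levels `1 ≤ m < k`) WITH SUPPORT: v6 FILE A with the γ JOIN lit ✓`B8SockHFP59GammaTraceFree.sockHFP_body_of_join_59_γ_traceFree`
  (★w3-19200 g9, p678428) in place of the RD join — print's split class `cubeLamBP′` (laws lit ✓`cubeLamBP'_hbox_pred` ∕ ✓`cubeLamBP'_hclass`), the boundary layer lit ✓`bdryLayer_cubeMember`,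
  (1.35) in the γ guard «box ⊂ □_{j−1}» from the tower row (lit ✓`bondBox_subset_tcube_of_subset_cubeFam` + ✓`ends_inBox_tilde_of_bondBox_subset_tcube`, = ✓`h135_cubeMember_γ`'s proof at
  generic `d`), (1.66)₀ at radius `α₁` from the tower row at `m′ := k` (lit ✓`collar_cube` + ✓`ends_of_sideTouches`), the exterior-collar constant `B_∂` with `4B_∂ ≤ (dL − 1)B₀`,
  [3] Prop. 4's windows one level lower + the γ-shape (1.61) window, and — replacing v6's b9 edge — THEOREM 4's OWN TWO-MEMBER (1.59) CLAUSE PER DATUM AT EVERY LEVEL `H59D` in the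
  JOIN's shape at `U₀ := 1` (= px10 g3's ✓`H59D_allLevels_flat_member5` per-datum text at `c := c⋆`; [4] Thm 3.3 at `U = 1`, a THEOREM on print's sub-lattice); the [4] letters
  `SLetτ : ∀ n, 1 ≤ n → n ≤ k → …` and the JOIN's window conjunction `hwin` EXACTLY as v6 (`SLetτ` = ✓`HalvingSLetTauFlatCubeMember.sLetτAll_flat_cubeMember_printed`'s body, a THEOREM
  on print's sub-lattice, p689656); conclusion = lit ✓`hP5_of_HFP_mem`'s (= px3's `hP5γ` body).
HONEST SCOPE.  By-name plumbing over landed lit theorems; the [4] letters, the (1.59) clause and the windows are DISPLAYED hypotheses here (theorems elsewhere); nothing of [4],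
Prop. 3 ∕ 5, Theorem 4, `hT4Tγ` or the stub is proved here.  Rung R3 (YM₃ on T³), NOT Clay; YM gap NOT proved.

References: T. Bałaban, CMP **99** (1985) 75–102 [Balaban1985RegularSpaces] (Prop. 5 (1.106)–(1.109) p.94, Thm 4 p.88, (1.58)–(1.59) p.86, (1.66)–(1.69) pp.87–88, (1.29) p.81,
(1.31) p.82, (1.35) p.82, (1.38) p.82, (1.131) p.99, p.98, p.76 «G = SU(N)»); CMP **99** (1985) 389–434 [Balaban1985BackgroundPropagators] (Thm 3.1 p.397, (3.25) p.394, Thm 3.3 p.398);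
CMP **98** (1985) 17–51 [Balaban1985Averaging] ((43) p.24); CMP **96** (1984) 223–250 [Balaban1984PropagatorsII] (Prop. 4).
-/

set_option autoImplicit false

noncomputable section

open scoped BigOperators
open NormedSpace
open Complex (I)

namespace Summit.QuantumFields.YangMills.Theorems.HalvingHSiteRawP5GammaOfLeaf

open Literature.MathematicalPhysics.QuantumFieldTheory.Balaban1983to89
open MatrixLog (mlog)
open B7Prop1Explicit (e expUnit U1 Site)
open B7Prop2Explicit (unitaryUnits unitaryUnits_le_U1 C0 c2' avgIter AvgClosed)
open B7Prop3Flat (c3)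
open B7Prop10General (C6 C4G)
open B7Prop9Flat (C5')
open B7Prop1Local (InBox loK bondHiK)
open B7Eq78Linearization (conjR zdBlocking QprimeIter)
open B7Eq92Concrete (mgauge mgauge_apply Rc Rc_apply)
open B8Ineq130 (tlo thi)
open B8Ineq132 (covDerivFwd covDeriv InAk BondTouches)
open B8Eq119TwistedAxial (Restr129 InAx bgT)
open B8Eq184Proof (gaugeExp cfgExp)
open B8Eq182Proof (gAd)
open B8Eq188Proof (frakF3)
open B8Lemma1NonAbelian (mulCfg)
open B8Eq140Level (SideTouches)
open B8Eq146AExpansion (iEta)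
open B8Eq138LandauZd (IsLandau138W covDivB covLap QT isLandau138W_congr)
open B7Prop4GeneralLevels (linCovIter)
open B8Eq155JBound (Jcur wsup)
open B8ScaledSupNorm (bondNorm msup)
open B8Ineq125Concrete (C2p)
open B8Eq1117Concrete (XSpace)
open B8Prop5ContractionKLevel (Bd2 Mc Kc)
open B8LambdaSpaceKLevel (wt)
open B8Prop6OfThm4 (one_inAk)
open B8Eq131Cubes (tLo tHi collar_cube)
open B8Eq131CubesAdmissible (cubeFam cubeFam_false_of_le)
open B8CubeMemberZd (cubeLamS cubeLamB hΩ_cubeFam)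
open B9SupplySockB9P3ZdBeta (CrossB)
open B9SupplySockB9P3ZdGamma (cubeLamBP')
open B8CubeMemberLamBPrimeLaws (cubeLamBP'_hbox_pred cubeLamBP'_hclass)
open B8LeafKnitZd3CubBdryBeta (bdryLayer_cubeMember)
open B8Ineq133CubeMemberGamma (ends_inBox_tilde_of_bondBox_subset_tcube bondBox_subset_tcube_of_subset_cubeFam)
open B8SockHFPCubeMember (htw_cubeLamS h8lt_cubeLamS h8top_cubeLamS)
open B8SockHFPTraceFree (sockHFP₀_body_of_join_RD_traceFree)
open B8SockHFP59GammaTraceFree (sockHFP_body_of_join_59_γ_traceFree)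
open B8SockHFPTorusTraceFree (apply_eq_zero_of_cfgExp_mem)
open B8Prop5KLevelLettersG (hP5_step_of_HFP_mem)
open B8Thm4TruncationLocal (base_datum)
open HalvingP1FlatCoreSupplierInduction (h34_of_inAk_univ hAx_of_inAx_one ends_of_sideTouches)

variable {d : ℕ} {𝔸 : Type*} [CStarAlgebra 𝔸] [Nontrivial 𝔸]

/-! ## The raw STEP socket `hP5γ` (levels `1 ≤ m < k`) with support, from the letters at truncation `m + 1` + Theorem 4's (1.59) clause for the datum at level `m` -/

set_option maxHeartbeats 400000 in
/-- ★★ **THE RAW PROPOSITION-5 STEP SOCKET IN `G`-FORM WITH SUPPORT, EDITION γ, AT N05's CUBE MEMBER OF RECORD AND THE FLAT BACKGROUND, FROM THE [4] LETTERS AT TRUNCATION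
`m + 1` AND THEOREM 4's OWN (1.59) CLAUSE FOR THE DATUM AT LEVEL `m`** — for every level `1 ≤ m < k` and every `G`-valued, `□₀`-supported level-`m` datum `(u₁, U₁, A)` of
Theorem 4's induction: `∃ (v, λ)`, `v` `G`-valued, `v = 1` off `□₀`, `v = e^{iλ}` on the touched sides, (1.108) at `α₄ = 8B₀′c⋆`, Landau (1.38) at `m + 1` for `U₁^{v⁻¹}`, (1.29)
at `m + 1` for `u₁v` — lit ✓`B8SockHFP59GammaTraceFree.sockHFP_body_of_join_59_γ_traceFree` at `(cubeFam false, cubeLamS, cubeLamBP′)`, `U₀ := 1` (laws lit ✓`hΩ_cubeFam` ∕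
✓`cubeLamBP'_hbox_pred` ∕ ✓`cubeLamBP'_hclass` ∕ ✓`bdryLayer_cubeMember` ∕ ✓`htw_cubeLamS` ∕ ✓`h8lt_cubeLamS` ∕ ✓`h8top_cubeLamS`; J3's rows ↦ `h33 h34 hAx h135 h66`), then lit
✓`hP5_step_of_HFP_mem` with (G3); conclusion = lit ✓`hP5_of_HFP_mem`'s.  See the module docstring for the edition-γ inputs `H59D`, `B_∂`, the γ windows.
[cite: Balaban1985RegularSpaces, Prop. 5 (1.106)-(1.109) p.94, Thm 4 p.88, (1.58)-(1.59) p.86, (1.67)-(1.69) p.88, (1.31) p.82, (1.35) p.82, (1.131) p.99, p.98, p.76; Balaban1985BackgroundPropagators, Thm 3.1 p.397, (3.25) p.394, Thm 3.3 p.398; Balaban1984PropagatorsII, Prop. 4] -/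
theorem rawP5γ_of_lettersτ_cubeMember (τ : 𝔸 →L[ℂ] ℂ) (hτ : ∀ x y : 𝔸, τ (x * y) = τ (y * x)) (hd2 : 2 ≤ d) {L : ℕ} (hL : 2 ≤ L) {η : ℝ} (hη : 0 < η)
    {k : ℕ}
    -- the groups of the joint J-SU: `G` (averaging-closed, unitary; `1, U′, u₁ ∈ G`) `≤ H` ((H2), (H3)), and (G3) `e^{iλ} ∈ G` for Hermitian `τ`-free `λ`
    -- (at `M₂(ℂ)`: `SU(2) ≤ SL(2, ℂ)` by lit ✓`B8SpecialLinearTrace`, (G3) by lit ✓`B8SpecialUnitaryTrace.gaugeExp_mem_specialUnitaryUnits`)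
    {G H : Subgroup 𝔸ˣ} (hGrp2 : ∀ g ∈ H, ‖(g : 𝔸) - 1‖ ≤ 1 / 8 → τ (mlog (g : 𝔸)) = 0) (hGrp3 : ∀ S : 𝔸, τ S = 0 → expUnit S ∈ H)
    (hGA : AvgClosed d L G) (hGH : G ≤ H) (hGu : G ≤ unitaryUnits 𝔸)
    (hG3 : ∀ lam : Site d → 𝔸, (∀ x, IsSelfAdjoint (lam x)) → (∀ x, τ (lam x) = 0) → ∀ x, gaugeExp lam x ∈ G)
    -- N05's cube member OF RECORD `Ω_j := □_j = cubeFam false L a M ρ k j` with its tower families (lit `B8CubeMemberZd`; defining equations, callers write `rfl`)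
    (aC : Site d) (M : ℕ) {ρ : ℕ} (hρ : L ≤ ρ)
    {Ω : ℕ → Set (Site d)} (hΩdef : Ω = cubeFam false L aC M ρ k)
    {Λs : ℕ → ℕ → Set (Site d)} (hΛsdef : Λs = cubeLamS L aC M ρ k)
    {Λb : ℕ → ℕ → Set (Site d × Fin d)} (hΛbdef : Λb = cubeLamBP' L aC M ρ k)
    -- the constants and the pre-gauged field `U′` of J3 (`G`-valued), with J3's three rows: (1.34)-𝔄 on `ℤᵈ`, axial at the flat background for every family, the tower row (d)
    {α₀ α₁ B₀ B₀' : ℝ} (hα₀ : 0 < α₀) (hα₁ : 0 < α₁) (hB₀ : 0 < B₀) (hB₀' : 0 < B₀')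
    {U' : Site d → Fin d → 𝔸ˣ} (hU'G : ∀ x κ, U' x κ ∈ G)
    (hInAk : InAk L k η α₀ (fun _ => (Set.univ : Set (Site d))) U')
    (hAxJ : ∀ m', m' ≤ k → ∀ Λ : ℕ → Set (Site d), InAx L m' Λ (1 : Site d → Fin d → 𝔸ˣ) U')
    (htw : ∀ m', m' ≤ k → ∀ (x : Site d) (ν : Fin d), tlo L (tLo aC ρ) m' ≤ x → x + e ν ≤ thi L (tHi aC M ρ) m' →
      ‖((avgIter L U' (k - m') x ν : 𝔸ˣ) : 𝔸) - 1‖ < α₁)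
    -- EDITION γ: the exterior-collar constant `B_∂` with its window, and THEOREM 4's own two-member (1.59) clause PER DATUM AT EVERY LEVEL `1 ≤ m < k` at the flat background,
    -- in the JOIN's shape (lit `H59Dβm` at `U₀ := 1`: class `Λb m` = print's split class `cubeLamBP′ … k m` ∪ the level-0 crossing bonds of `□₀`, collar allowance `B_∂`) — px10 g3's
    -- ✓`H59D_allLevels_flat_member5` per-datum text at `c := c⋆` ([4] Thm 3.3 at `U = 1` on print's sub-lattice); replaces v6's b9 edge `SB9all`
    {Bbd : ℝ} (hBbd : 0 ≤ Bbd) (hBd : 4 * Bbd ≤ ((d : ℝ) * L - 1) * B₀)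
    (H59D : ∀ m, 1 ≤ m → m < k → ∀ (U₁ : Site d → Fin d → 𝔸ˣ) (A' : Site d → Fin d → 𝔸),
      IsLandau138W L m η (Ω 0) (Λs m) (1 : Site d → Fin d → 𝔸ˣ) U₁ →
      (∀ j, j ≤ m → ∀ (y : Site d) (ν : Fin d), SideTouches (Ω j) y ν →
        U₁ y ν = cfgExp η A' y ν ∧ ‖A' y ν‖ ≤ (5 * (d : ℝ) * L * B₀ * (α₀ + α₁)) * ((L : ℝ) ^ j * η)⁻¹) →
      (∀ (y : Site d) (ν : Fin d), (∀ j, j ≤ m → ¬ SideTouches (Ω j) y ν) → A' y ν = 0) →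
      msup L m η (-(1 : ℝ)) (fun j (b : Site d × Fin d) => SideTouches (Ω j) b.1 b.2) (fun b => A' b.1 b.2)
          ≤ B₀ * (bondNorm L m η (-(3 : ℝ)) Ω (fun x μ => Jcur η (1 : Site d → Fin d → 𝔸ˣ) A' μ x)
            + wsup 1 (fun p : {p : ℕ × (Site d × Fin d) // p.1 ≤ m ∧ (p.2 ∈ Λb m p.1 ∨ (p.1 = 0 ∧ CrossB (Ω 0) p.2))} =>
                linCovIter L (1 : Site d → Fin d → 𝔸ˣ) (iEta η A') p.1.1 p.1.2.1 p.1.2.2))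
            + Bbd * msup L m η (-(1 : ℝ)) (fun j (b : Site d × Fin d) => j = 0 ∧ SideTouches (Ω 0) b.1 b.2 ∧ ¬ BondTouches (Ω 0) b.1 b.2)
                (fun b => A' b.1 b.2) ∧
        msup L m η (-(2 : ℝ)) (fun j (t : Fin d × Fin d × Site d) => SideTouches (Ω j) t.2.2 t.2.1)
            (fun t => covDerivFwd η (1 : Site d → Fin d → 𝔸ˣ) t.1 (fun z => A' z t.2.1) t.2.2)
          ≤ B₀ * (bondNorm L m η (-(3 : ℝ)) Ω (fun x μ => Jcur η (1 : Site d → Fin d → 𝔸ˣ) A' μ x)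
            + wsup 1 (fun p : {p : ℕ × (Site d × Fin d) // p.1 ≤ m ∧ (p.2 ∈ Λb m p.1 ∨ (p.1 = 0 ∧ CrossB (Ω 0) p.2))} =>
                linCovIter L (1 : Site d → Fin d → 𝔸ˣ) (iEta η A') p.1.1 p.1.2.1 p.1.2.2))
            + Bbd * msup L m η (-(1 : ℝ)) (fun j (b : Site d × Fin d) => j = 0 ∧ SideTouches (Ω 0) b.1 b.2 ∧ ¬ BondTouches (Ω 0) b.1 b.2)
                (fun b => A' b.1 b.2))
    -- EDITION γ: [3] Prop. 4's windows ONE LEVEL LOWER at `(L²α₀, L·c⋆)` and the (1.61) window with the γ remainder constant `C₂` (packs: ✓`gammaWindows_of_hw`)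
    {C₂ : ℝ}
    (hα3γ : C0 d * ((L : ℝ) ^ 2 * α₀) ≤ 1 / 3) (hα4γ : 4 * ((L : ℝ) ^ 2 * α₀) ≤ c2' d L)
    (h16γ : 16 * ((L : ℝ) * (5 * (d : ℝ) * L * B₀ * (α₀ + α₁))) ≤ 1)
    (hsmallγ : Real.exp (4 * (800 * ((d : ℝ) + 1) ^ 2 * ((d : ℝ) + 4)) * ((L : ℝ) ^ 2 * α₀))
      * (1 + 8 * (131072 * ((d : ℝ) + 1) ^ 2) * ((L : ℝ) * (5 * (d : ℝ) * L * B₀ * (α₀ + α₁)))) ≤ 2)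
    (hc₃γ : 2 * ((L : ℝ) * (5 * (d : ℝ) * L * B₀ * (α₀ + α₁))) ≤ c3 d L)
    (hC₂γ : 8 * (131072 * ((d : ℝ) + 1) ^ 2) * Real.exp (4 * (800 * ((d : ℝ) + 1) ^ 2 * ((d : ℝ) + 4)) * ((L : ℝ) ^ 2 * α₀)) * (L : ℝ) ^ 2 ≤ C₂)
    (h61γ : 2 * (5 * (d : ℝ) * L * B₀ * (α₀ + α₁)) ^ 2 + 20 * d * α₀ * (5 * (d : ℝ) * L * B₀ * (α₀ + α₁))
      + 2 * C₂ * (5 * (d : ℝ) * L * B₀ * (α₀ + α₁)) ^ 2 ≤ α₀ + α₁)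
    -- (the JOIN's window conjunction below keeps its two b9 letters `cB9`, unused in edition γ, so that lit ✓`hfpWindows_of_guard` feeds it verbatim)
    {cB9 : ℝ}
    -- the [4] LETTERS AT EVERY TRUNCATION `n ≤ k` AT THE FLAT BACKGROUND, AS ONE ∃-PACKAGE PER `n`: lit `SockLettersRD`'s body at `(α₀, U₀ := 1, n)` ∧ lit `LettersTau`'s three
    -- fields (the shape of ✓p654110's `SLetτ`, there at `n := m + 1` only) — [4] Thm 3.1 ∕ (3.25) for Bałaban's operators `G Δ Q Q* A C H′` on the member's cube families (N05∕N06)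
    {B₀'H B₂' BG BR : ℝ} (hB₀'H : 0 < B₀'H) (hB₂' : 0 ≤ B₂') (hBG : 0 ≤ BG) (hBR : 0 ≤ BR)
    (SLetτ : ∀ n, 1 ≤ n → n ≤ k → ∃ (g Δ : (Site d → 𝔸) →ₗ[ℂ] (Site d → 𝔸)) (q : (Site d → 𝔸) →ₗ[ℂ] (ℕ → Site d → 𝔸))
        (qs : (ℕ → Site d → 𝔸) →ₗ[ℂ] (Site d → 𝔸)) (Aw c : (ℕ → Site d → 𝔸) →ₗ[ℂ] (ℕ → Site d → 𝔸)) (H' : XSpace d n 𝔸 →ₗ[ℂ] (Site d → 𝔸)),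
      (∀ x, ∀ y ∈ Ω 0, (Δ (g x) + qs (Aw (q (g x)))) y = x y) ∧ (∀ f, q (g (g (qs (c (q f))))) = q f) ∧
      (∀ (f : Site d → 𝔸), ∀ x ∈ Ω 0, Δ f x = covLap η (1 : Site d → Fin d → 𝔸ˣ) ((Ω 0).indicator f) x) ∧
      (∀ (μ : ℕ → Site d → 𝔸), ∀ x ∈ Ω 0, qs μ x = QT L n (Λs n) (1 : Site d → Fin d → 𝔸ˣ) μ x) ∧
      (∀ (f : Site d → 𝔸) (j : ℕ), j ≤ n → ∀ y ∈ Λs n j, q f j y = QprimeIter (zdBlocking d L) (bgT L (1 : Site d → Fin d → 𝔸ˣ)) j f y) ∧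
      (∀ (X : XSpace d n 𝔸) (x : Site d), ‖H' X x‖ ≤ B₀'H * ‖X‖) ∧
      (∀ j, j ≤ n → ∀ (X : XSpace d n 𝔸), ∀ p ∈ {b : Site d × Fin d | SideTouches (Ω j) b.1 b.2},
        wt L η j * ‖covDerivFwd η (1 : Site d → Fin d → 𝔸ˣ) p.2 (H' X) p.1‖ ≤ B₀'H * ‖X‖) ∧
      (∀ X : XSpace d n 𝔸, Bd2 L η n Ω (covLap η (1 : Site d → Fin d → 𝔸ˣ) (H' X)) (B₂' * ‖X‖)) ∧
      (∀ (X : XSpace d n 𝔸) (x : Site d), x ∉ Ω 0 → H' X x = 0) ∧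
      (∀ X Y : XSpace d n 𝔸, (∀ p, Y p = -star (X p)) → ∀ x, H' Y x = -star (H' X x)) ∧
      (∀ (Y : XSpace d n 𝔸) (j : ℕ) (hj : j ≤ n) (y : Site d), y ∈ Λs n j →
        QprimeIter (zdBlocking d L) (bgT L (1 : Site d → Fin d → 𝔸ˣ)) j (H' Y) y = Y (⟨j, Nat.lt_succ_of_le hj⟩, y)) ∧
      (∀ (f : Site d → 𝔸) (r : ℝ), 0 ≤ r → Bd2 L η n Ω f r →
        (∀ x, ‖g f x‖ ≤ BG * r) ∧ ∀ j, j ≤ n → ∀ p ∈ {b : Site d × Fin d | SideTouches (Ω j) b.1 b.2},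
          wt L η j * ‖covDerivFwd η (1 : Site d → Fin d → 𝔸ˣ) p.2 (g f) p.1‖ ≤ BG * r) ∧
      (∀ (f : Site d → 𝔸) (x : Site d), x ∉ Ω 0 → g f x = 0) ∧
      (∀ f : Site d → 𝔸, (∀ j, j ≤ n → ∀ x ∈ Ω j, IsSelfAdjoint (f x)) → ∀ x, IsSelfAdjoint (g f x)) ∧
      (∀ (f : Site d → 𝔸) (r : ℝ), 0 ≤ r → Bd2 L η n Ω f r → Bd2 L η n Ω (f - g (qs (c (q (g f))))) (BR * r)) ∧
      (∀ f : Site d → 𝔸, (∀ j, j ≤ n → ∀ x ∈ Ω j, IsSelfAdjoint (f x)) → ∀ j, j ≤ n → ∀ x ∈ Ω j, IsSelfAdjoint ((f - g (qs (c (q (g f))))) x)) ∧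
      (∀ X : XSpace d n 𝔸, (∀ p, τ (X p) = 0) → ∀ x, τ (H' X x) = 0) ∧
      (∀ f : Site d → 𝔸, (∀ j, j ≤ n → ∀ x ∈ Ω j, τ (f x) = 0) → ∀ x, τ (g f x) = 0) ∧
      (∀ f : Site d → 𝔸, (∀ j, j ≤ n → ∀ x ∈ Ω j, τ (f x) = 0) → ∀ j, j ≤ n → ∀ x ∈ Ω j, τ ((f - g (qs (c (q (g f))))) x) = 0))
    -- the JOIN's scalar windows at this `(α₀, α₁)` AS ONE CONJUNCTION — letter for letter the conclusion of lit ✓`B8SockHFPWindows.hfpWindows_of_guard` (= the `hwin` of lit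
    -- ✓`B8SockHFPTorusTraceFree.sockHFPτ_family_of_lettersAt`): Prop. 3's four, the b9 thresholds, the Sect. D∕E JOIN's, at `c⋆ = 5dLB₀(α₀ + α₁)`, `α₄ = 8B₀′c⋆`, `cB = cA = L·c⋆`, `cDA = 2dL²·c⋆`
    (hwin : ∀ cs α₄ cB cDA hE hE₂ lE lE₂ : ℝ, cs = 5 * (d : ℝ) * L * B₀ * (α₀ + α₁) → α₄ = 8 * B₀' * (5 * (d : ℝ) * L * B₀) * (α₀ + α₁) →
      cB = L * cs → cDA = 2 * (d : ℝ) * (L : ℝ) ^ 2 * cs →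
      hE = B₀'H * (C2p d * (40 * d * cB + α₄) * α₄) → hE₂ = B₂' * (C2p d * (40 * d * cB + α₄) * α₄) →
      lE = B₀'H * (4 * C2p d * (40 * d * cB + 2 * α₄)) → lE₂ = B₂' * (4 * C2p d * (40 * d * cB + 2 * α₄)) →
      36 * d * B₀ * cs ≤ 1 / 2 ∧
      8 * (131072 * ((d : ℝ) + 1) ^ 2) * Real.exp (4 * (800 * ((d : ℝ) + 1) ^ 2 * ((d : ℝ) + 4)) * α₀) ≤ 16 * (131072 * ((d : ℝ) + 1) ^ 2) ∧
      2 * cs ^ 2 + 20 * d * α₀ * cs + 2 * (16 * (131072 * ((d : ℝ) + 1) ^ 2)) * cs ^ 2 ≤ α₀ + α₁ ∧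
      (d : ℝ) * L * α₁ ≤ 1 / 8 ∧
      α₀ ≤ cB9 ∧ cs ≤ cB9 ∧
      C0 d * α₀ ≤ 1 / 3 ∧ 4 * α₀ ≤ c2' d L ∧
      Real.exp (4 * (800 * ((d : ℝ) + 1) ^ 2 * ((d : ℝ) + 4)) * α₀) * (1 + 8 * (131072 * ((d : ℝ) + 1) ^ 2) * cB) ≤ 2 ∧
      2 * cB ≤ c3 d L ∧ 2048 * (d : ℝ) * cB ≤ 1 ∧ 40 * d * cB ≤ 1 / 200 ∧
      200 * C6 d * (2 * α₄) ≤ 1 ∧ 12000 * ((d : ℝ) + 1) * L * (2 * α₄) ≤ 1 ∧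
      C4G d L * (α₀ + 40 * d * cB + 4 * (2 * α₄)) ≤ 1 ∧
      1024 * ((d : ℝ) + 1) * ((d : ℝ) + 4) * L ^ 2 * α₀ ≤ 1 ∧ 32 * ((d : ℝ) + 1) ^ 2 * C6 d * L ^ 2 * α₀ ≤ 1 ∧
      16 * d * C5' d * C6 d * (L : ℝ) ^ 2 * α₀ ≤ 1 ∧ 8 * d * C6 d * L * α₀ ≤ 1 ∧
      40 * d * cB + α₄ ≤ 1 / (4 * B₀'H * (2 * C2p d)) ∧ 2 * C6 d * (40 * d * cB + 4 * α₄) ≤ 1 / 8 ∧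
      cB ≤ 1 / 13 ∧ α₄ / 4 + hE ≤ 1 / 24 ∧ α₄ / 4 + hE ≤ 1 / 140 ∧ 10 * (α₄ / 4 + hE) * BR ≤ 1 / 2 ∧
      BG * Mc d BR (α₄ / 4 + hE) cB hE₂ cDA ≤ α₄ / 4 ∧
      BG * Kc d BR (α₄ / 4 + hE) cB hE₂ cDA lE₂ (1 + lE) (1 + lE) ≤ 1 / 2) :
    ∀ m, 1 ≤ m → m < k → ∀ (u₁ : Site d → 𝔸ˣ) (U₁ : Site d → Fin d → 𝔸ˣ) (A : Site d → Fin d → 𝔸),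
      (∀ x, u₁ x ∈ G) → (∀ x, x ∉ Ω 0 → u₁ x = 1) → mgauge (1 : Site d → Fin d → 𝔸ˣ) u₁ U₁ = U' → Restr129 L m (Λs m) (1 : Site d → Fin d → 𝔸ˣ) u₁ →
      IsLandau138W L m η (Ω 0) (Λs m) (1 : Site d → Fin d → 𝔸ˣ) U₁ →
      (∀ j, j ≤ m → ∀ b ∈ {b : Site d × Fin d | SideTouches (Ω j) b.1 b.2},
        U₁ b.1 b.2 = cfgExp η A b.1 b.2 ∧ IsSelfAdjoint (A b.1 b.2) ∧ ‖A b.1 b.2‖ ≤ (5 * (d : ℝ) * L * B₀ * (α₀ + α₁)) * ((L : ℝ) ^ j * η)⁻¹) →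
      ∃ (v : Site d → 𝔸ˣ) (lam : Site d → 𝔸), (∀ x, v x ∈ G) ∧ (∀ x, x ∉ Ω 0 → v x = 1) ∧
        (∀ j, j ≤ m + 1 → ∀ b ∈ {b : Site d × Fin d | SideTouches (Ω j) b.1 b.2}, (v b.1 : 𝔸) = ((gaugeExp lam b.1 : 𝔸ˣ) : 𝔸) ∧
          (v (b.1 + e b.2) : 𝔸) = ((gaugeExp lam (b.1 + e b.2) : 𝔸ˣ) : 𝔸)) ∧
        (∀ j, j ≤ m + 1 → ∀ b ∈ {b : Site d × Fin d | SideTouches (Ω j) b.1 b.2},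
          ‖lam b.1‖ ≤ 8 * B₀' * (5 * (d : ℝ) * L * B₀) * (α₀ + α₁) ∧
            ((L : ℝ) ^ j * η) * ‖covDerivFwd η (1 : Site d → Fin d → 𝔸ˣ) b.2 lam b.1‖ ≤ 8 * B₀' * (5 * (d : ℝ) * L * B₀) * (α₀ + α₁)) ∧
        IsLandau138W L (m + 1) η (Ω 0) (Λs (m + 1)) (1 : Site d → Fin d → 𝔸ˣ) (mgauge (1 : Site d → Fin d → 𝔸ˣ) v⁻¹ U₁) ∧
        Restr129 L (m + 1) (Λs (m + 1)) (1 : Site d → Fin d → 𝔸ˣ) (u₁ * v) := by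
  intro m hm1 hmk u₁ U₁ A hu₁G hu₁S hW h129 hLan hdat
  subst hΩdef hΛsdef hΛbdef
  have hL1 : 1 ≤ L := le_trans (by norm_num) hL
  have hLr : (1 : ℝ) ≤ L := by exact_mod_cast hL1
  have hρ1 : 1 ≤ ρ := hL1.trans hρ
  have hmK : m + 1 ≤ k := hmk
  -- the windows at this `(α₀, α₁)`
  obtain ⟨hside, hC₂, h61, hsmall₁, hα₀9, hcs9, hα3, hα4, hsmall, hc₃, hsc, hα₃', hs₁, hs₂, hs₃, hs₄, hs₅, hs₆, hs₇, hsm, hprod8, hcA', ha₁',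
    hb₁', hθ, h103, h106⟩ := hwin _ _ _ _ _ _ _ _ rfl rfl rfl rfl rfl rfl rfl rfl
  have hcs0 : 0 ≤ 5 * (d : ℝ) * L * B₀ * (α₀ + α₁) := by
    have : 0 ≤ α₀ + α₁ := by linarith
    positivity
  have hcDAlo : (d : ℝ) * (L : ℝ) ^ 2 * (5 * (d : ℝ) * L * B₀ * (α₀ + α₁)) ≤ 2 * (d : ℝ) * (L : ℝ) ^ 2 * (5 * (d : ℝ) * L * B₀ * (α₀ + α₁)) := by
    have h := mul_nonneg (by positivity : (0 : ℝ) ≤ (d : ℝ) * (L : ℝ) ^ 2) hcs0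
    linarith only [h]
  -- `c⋆ ≤ 1∕8000` (hence `16c⋆ ≤ 1`, `c⋆ ≤ 1∕12`) and `α₄ ≤ 1∕84` from the JOIN's windows
  have h16 : 16 * (5 * (d : ℝ) * L * B₀ * (α₀ + α₁)) ≤ 1 := by
    have hd0 : (1 : ℝ) ≤ d := by exact_mod_cast (show 1 ≤ d by omega)
    have hcsB : 5 * (d : ℝ) * L * B₀ * (α₀ + α₁) ≤ L * (5 * (d : ℝ) * L * B₀ * (α₀ + α₁)) := le_mul_of_one_le_left hcs0 hLr
    have hcBsmall : (d : ℝ) * (L * (5 * (d : ℝ) * L * B₀ * (α₀ + α₁))) ≤ 1 / 8000 := by linarith only [hα₃']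
    have h1 : 5 * (d : ℝ) * L * B₀ * (α₀ + α₁) ≤ 1 / 8000 :=
      ((le_mul_of_one_le_left hcs0 hd0).trans (mul_le_mul_of_nonneg_left hcsB (by positivity))).trans hcBsmall
    linarith only [h1]
  have hcs12 : 5 * (d : ℝ) * L * B₀ * (α₀ + α₁) ≤ 1 / 12 := by linarith only [h16, hcs0]
  have hα84 : 8 * B₀' * (5 * (d : ℝ) * L * B₀) * (α₀ + α₁) ≤ 1 / 84 := by
    have hC6 : (2 : ℝ) ≤ C6 d := B7ConclGaugeLin.two_le_C6'
    have hα₄0 : 0 ≤ 8 * B₀' * (5 * (d : ℝ) * L * B₀) * (α₀ + α₁) := by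
      have : 0 ≤ α₀ + α₁ := by linarith
      positivity
    have h := mul_le_mul_of_nonneg_right hC6 (by positivity : (0 : ℝ) ≤ 200 * (2 * (8 * B₀' * (5 * (d : ℝ) * L * B₀) * (α₀ + α₁))))
    nlinarith only [hs₁, h, hα₄0]
  -- the member geometry (lit `B8CubeMemberZd` ∕ `B8SockHFPCubeMember`, BY NAME)
  have hΩ := hΩ_cubeFam (d := d) hL1 aC M hρ k
  have hk1 : 1 ≤ k := by omega
  have hbox := cubeLamBP'_hbox_pred (d := d) hL1 aC M hρ k
  have hclass := cubeLamBP'_hclass (d := d) hL1 aC M hρ k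
  have hlay := bdryLayer_cubeMember (d := d) hL aC M ρ k hρ hk1
  have htower := htw_cubeLamS (d := d) hL1 aC M ρ k (m + 1) hmK
  have hlt := h8lt_cubeLamS (d := d) L aC M ρ k m hmk
  have htop := h8top_cubeLamS (d := d) hL1 aC M ρ k m hmk
  -- the pre-gauged field's rows at the flat background: (1.33) of `1`, (1.34)∕(Ax)∕(1.35) from J3's currency (✓p647600 §1)
  have h33 : InAk L k η α₀ (cubeFam false L aC M ρ k) (1 : Site d → Fin d → 𝔸ˣ) := one_inAk hL1 k hη hα₀ _
  have h34 := h34_of_inAk_univ hInAk (cubeFam false L aC M ρ k)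
  have hAx := hAx_of_inAx_one hAxJ (cubeLamS L aC M ρ k)
  -- (1.35) in PRINT's γ guard «box ⊂ □_{j−1}» from the tower row (d) (= ✓`h135_cubeMember_γ`'s proof at generic `d`)
  have h135 : ∀ j, j ≤ k → ∀ (z : Site d) (μ : Fin d), (∀ x, InBox (loK L j z) (bondHiK L j z μ) x → x ∈ cubeFam false L aC M ρ k (j - 1)) →
      ‖(avgIter L (mulCfg U' (1 : Site d → Fin d → 𝔸ˣ)) j z μ : 𝔸) - (avgIter L (1 : Site d → Fin d → 𝔸ˣ) j z μ : 𝔸)‖ ≤ α₁ := by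
    intro j hj z μ hbx
    obtain ⟨h1, h2⟩ := ends_inBox_tilde_of_bondBox_subset_tcube hL1 aC M ρ hj
      (bondBox_subset_tcube_of_subset_cubeFam hL aC M hρ1 ((Nat.sub_le j 1).trans hj) hbx)
    rw [HalvingP1FlatCoreSupplierInduction.mulCfg_one_right, B8Ineq132.avgIter_one, Pi.one_apply, Pi.one_apply, Units.val_one]
    have h := htw (k - j) (Nat.sub_le _ _) z μ h1 h2
    rw [Nat.sub_sub_self hj] at h
    exact h.le
  -- (1.66) at radius `α₁` on the sides touching `□₀`: the tower row at `m′ := k` (`Ū⁰ = U′`) on the collar `□̃`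
  have h66 : ∀ b ∈ {b : Site d × Fin d | SideTouches (cubeFam false L aC M ρ k 0) b.1 b.2}, ‖((U' b.1 b.2 : 𝔸ˣ) : 𝔸) - 1‖ ≤ α₁ := by
    intro b hb
    have hb' : SideTouches (cubeFam false L aC M ρ k 0) b.1 b.2 := hb
    rw [cubeFam_false_of_le L aC M ρ (Nat.zero_le k)] at hb'
    obtain ⟨h1, h2⟩ := ends_of_sideTouches (collar_cube hL hρ1 (Nat.zero_le k)) hb'
    have h := htw k le_rfl b.1 b.2 h1 h2
    rw [Nat.sub_self, B7Prop2Explicit.avgIter_zero] at h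
    exact h.le
  -- group data: `1, U′ ∈ G`; `u₁ ∈ G ≤ H ≤ U(𝔸)`; `U₁ = u₁⁻¹·U′·u₁(· + e) ∈ G`
  have h1G : ∀ (x : Site d) (κ : Fin d), (1 : Site d → Fin d → 𝔸ˣ) x κ ∈ G := fun _ _ => G.one_mem
  have hU' : ∀ x κ, U' x κ ∈ unitaryUnits 𝔸 := fun x κ => hGu (hU'G x κ)
  have hu₁ : ∀ x, u₁ x ∈ unitaryUnits 𝔸 := fun x => hGu (hu₁G x)
  have hu₁H : ∀ x, u₁ x ∈ H := fun x => hGH (hu₁G x)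
  have hU₁G : ∀ x κ, U₁ x κ ∈ G := by
    intro x κ
    have h := congrFun (congrFun hW x) κ
    rw [mgauge_apply] at h
    have hU₁ : U₁ x κ = (u₁ x)⁻¹ * U' x κ * Rc ((1 : Site d → Fin d → 𝔸ˣ) x κ) (u₁ (x + e κ)) := by
      rw [← h]; group
    rw [hU₁, Rc_apply]
    exact G.mul_mem (G.mul_mem (G.inv_mem (hu₁G x)) (hU'G x κ))
      (G.mul_mem (G.mul_mem (h1G x κ) (hu₁G _)) (G.inv_mem (h1G x κ)))
  -- the datum's exponent is `τ`-free on every touched side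
  have hAτ : ∀ j, j ≤ m → ∀ b ∈ {b : Site d × Fin d | SideTouches (cubeFam false L aC M ρ k j) b.1 b.2}, τ (A b.1 b.2) = 0 := by
    intro j hj b hb
    obtain ⟨hexp, -, hbd⟩ := hdat j hj b hb
    have hmem : cfgExp η A b.1 b.2 ∈ G := by rw [← hexp]; exact hU₁G b.1 b.2
    refine apply_eq_zero_of_cfgExp_mem τ hGH hGrp2 hη hmem ?_
    have hLj : (1 : ℝ) ≤ (L : ℝ) ^ j := one_le_pow₀ hLr
    calc η * ‖A b.1 b.2‖ ≤ η * ((5 * (d : ℝ) * L * B₀ * (α₀ + α₁)) * ((L : ℝ) ^ j * η)⁻¹) := mul_le_mul_of_nonneg_left hbd hη.le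
      _ = (5 * (d : ℝ) * L * B₀ * (α₀ + α₁)) * ((L : ℝ) ^ j)⁻¹ := by
          field_simp
      _ ≤ (5 * (d : ℝ) * L * B₀ * (α₀ + α₁)) * 1 := mul_le_mul_of_nonneg_left (inv_le_one_of_one_le₀ hLj) hcs0
      _ ≤ 1 / 16 := by linarith only [h16]
  -- the letters at truncation `m + 1` with their `τ`-laws
  obtain ⟨g, Δ, q, qs, Aw, c, H', g_rightΩ, c_range, hΔ, hqs, hq, hH0, hH1, hH2, hHsupp, hHequiv, hQH, hG, hGsupp, hGreal, hRbd, hRreal, hHτ, hGτ, hRτ⟩ :=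
    SLetτ (m + 1) (by omega) hmK
  -- Theorem 4's own (1.59) clause for THIS datum at level `m` (the Landau row is the datum's; the Hermitian antecedent is not needed)
  have H59Dβm := fun (A' : Site d → Fin d → 𝔸) (_ : ∀ y ν, IsSelfAdjoint (A' y ν)) => H59D m hm1 hmk U₁ A' hLan
  -- THE `τ`-FREE γ JOIN (lit ✓`B8SockHFP59GammaTraceFree`, BY NAME) at the member
  obtain ⟨lam, hlsa, hloff, hlτ, h108, hmul, h129'⟩ := sockHFP_body_of_join_59_γ_traceFree τ hτ hd2 hL hη hGrp2 hGrp3 hGA hGH hGu hΩ hbox hclass hm1 hmk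
    htower hlt htop hα₀ hα₁ hB₀ hB₀' rfl rfl h1G hU' h33 h34 hAx h135 h66 hlay hBbd hBd hu₁ hu₁H hu₁S hW h129 hLan hdat hAτ H59Dβm hside hC₂γ h61γ hsmall₁
    hα3γ hα4γ h16γ hsmallγ hc₃γ
    g Δ q qs Aw c g_rightΩ c_range hΔ hqs hq H' hB₀'H hB₂' hBG hBR hH0 hH1 hH2 hHsupp hHequiv hQH hG hGsupp hGreal hRbd hRreal hHτ hGτ hRτ
    le_rfl le_rfl hcDAlo hα3 hα4 hsmall hc₃ hsc hα₃' hs₁ hs₂ hs₃ hs₄ hs₅ hs₆ hs₇ hsm hprod8 rfl rfl rfl rfl hcA' ha₁' hb₁' hθ h103 h106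
  -- lit's `G`-form step adapter WITH SUPPORT (F4a ✓`hP5_step_of_HFP_mem`) with (G3)
  have h1u : ∀ (x : Site d) (κ : Fin d), (1 : Site d → Fin d → 𝔸ˣ) x κ ∈ unitaryUnits 𝔸 := fun _ _ => (unitaryUnits 𝔸).one_mem
  exact hP5_step_of_HFP_mem hd2 hη L m h1u hα84 hcs12 _ _ u₁ U₁ A hdat ⟨lam, hlsa, hloff, hG3 lam hlsa hlτ, h108, hmul, h129'⟩

end Summit.QuantumFields.YangMills.Theorems.HalvingHSiteRawP5GammaOfLeaf

end
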